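import Mathlib
import Summits.CriticalPhenomena.PercolationContinuityZ3.Theorems.PercNearOneGluingNoHeavyLowerTailOrientedAntipodalHallTournamentC3Source

/-!
# Theorem O for the 3-cycle with a sink on four petals (by duality)

Helper file for crux `stmt-CriticalPhenomena-4575` (`NoHeavyLowerTail`, route `PercNearOneGluingNoHeavy`),
new-inequality factory seat `prim-ineq-gen-3` (gen 12).  Everything here is PROVED.

Types `(i,j), (i,l), (j,l), (j,m), (m,i), (m,l)` — the 3-cycle `i → j → m → i` dominating the sink `l`.  This class is the REVERSE of
the 3-cycle with a source, and reversing all types is realised by the DUAL labeling `f⋆ U = (f (S \ U))ᵒᵖ` (swap `B` and `A`, fix the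
petals): `f⋆` is monotone, an antipodal bad of `f` of type `(p,q)` inside `S` is an antipodal bad of `f⋆` of type `(q,p)`, and the
good sets of `f` and `f⋆` inside `S` coincide (the dual label is a local function term in the proofs, no new definition).  Hence Theorem O for this
class (`card_le_card_goods_above_threeCycleSink`, `exists_injective_good_above_threeCycleSink`) follows from `…threeCycleSource` applied to `f⋆`.
With this file Conjecture O₄ — distinct good representatives above the antipodal bads of ANY opposite-free set of ordered types on
four petals, for every monotone labeling — is a theorem for all 41 classes (memo prim-ineq-gen-3/FINDINGS-gen12.md).
(prim-ineq-gen-3 gen 12, 2026-08-20.)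
-/

namespace Summit.CriticalPhenomena.PercolationContinuityZ3.Theorems

namespace OrientedAntipodalHall

open Finset AntipodalStrongHarris AntipodalStrongHarris.Lab
open scoped FinsetFamily

variable {α : Type*} [DecidableEq α] {k : ℕ}

/-- **Theorem O for the 3-cycle with a sink on four petals** (count form): types `(i,j), (i,l), (j,l), (j,m), (m,i), (m,l)`;
at least `#E₁ + ⋯ + #E₆` good sets contain a bad. -/
theorem card_le_card_goods_above_threeCycleSink (S : Finset α) {f : Finset α → Lab k}
    (hf : ∀ ⦃X Y : Finset α⦄, X ⊆ Y → f X ≤ f Y) (E₁ E₂ E₃ E₄ E₅ E₆ : Finset (Finset α)) {i j l m : Fin k}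
    (hij : i ≠ j) (hil : i ≠ l) (him : i ≠ m) (hjl : j ≠ l) (hjm : j ≠ m) (hlm : l ≠ m)
    (h1S : ∀ X ∈ E₁, X ⊆ S) (h1a : ∀ X ∈ E₁, f X = petal i) (h1b : ∀ X ∈ E₁, f (S \ X) = petal j)
    (h2S : ∀ X ∈ E₂, X ⊆ S) (h2a : ∀ X ∈ E₂, f X = petal i) (h2b : ∀ X ∈ E₂, f (S \ X) = petal l)
    (h3S : ∀ X ∈ E₃, X ⊆ S) (h3a : ∀ X ∈ E₃, f X = petal j) (h3b : ∀ X ∈ E₃, f (S \ X) = petal l)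
    (h4S : ∀ X ∈ E₄, X ⊆ S) (h4a : ∀ X ∈ E₄, f X = petal j) (h4b : ∀ X ∈ E₄, f (S \ X) = petal m)
    (h5S : ∀ X ∈ E₅, X ⊆ S) (h5a : ∀ X ∈ E₅, f X = petal m) (h5b : ∀ X ∈ E₅, f (S \ X) = petal i)
    (h6S : ∀ X ∈ E₆, X ⊆ S) (h6a : ∀ X ∈ E₆, f X = petal m) (h6b : ∀ X ∈ E₆, f (S \ X) = petal l)
    : #E₁ + #E₂ + #E₃ + #E₄ + #E₅ + #E₆ ≤
      #{U ∈ S.powerset | f U = top ∧ f (S \ U) = bot ∧ ∃ X ∈ E₁ ∪ E₂ ∪ E₃ ∪ E₄ ∪ E₅ ∪ E₆, X ⊆ U} := by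
  -- the dual label `d` (swap `B` and `A`, fix the petals) and the dual labeling `g U = d (f (S \ U))`
  set d : Lab k → Lab k := fun c => if c = bot then top else if c = top then bot else c with hd
  have d_anti : ∀ {x y : Lab k}, x ≤ y → d y ≤ d x := by
    intro x y h
    rw [le_def] at h ⊢
    rcases h with h | h | h <;> subst h
    · cases y <;> simp [hd]
    · cases x <;> simp [hd]
    · exact Or.inr (Or.inr rfl)
  have d_top : ∀ {c : Lab k}, d c = top ↔ c = bot := fun {c} => by cases c <;> simp [hd]
  have d_bot : ∀ {c : Lab k}, d c = bot ↔ c = top := fun {c} => by cases c <;> simp [hd]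
  have d_petal : ∀ q : Fin k, d (petal q) = petal q := fun q => by simp [hd]
  set g : Finset α → Lab k := fun U => d (f (S \ U)) with hg
  have hgmono : ∀ ⦃X Y : Finset α⦄, X ⊆ Y → g X ≤ g Y := fun X Y hXY => d_anti (hf (sdiff_subset_sdiff le_rfl hXY))
  have ga : ∀ {E : Finset (Finset α)} {q : Fin k}, (∀ X ∈ E, f (S \ X) = petal q) → ∀ X ∈ E, g X = petal q := by
    intro E q h X hX; simp only [hg, h X hX, d_petal]
  have gb : ∀ {E : Finset (Finset α)} {p : Fin k}, (∀ X ∈ E, X ⊆ S) → (∀ X ∈ E, f X = petal p) →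
      ∀ X ∈ E, g (S \ X) = petal p := by
    intro E p hS h X hX; simp only [hg, Finset.sdiff_sdiff_eq_self (hS X hX), h X hX, d_petal]
  -- the 3-cycle with a source for `g` with petals `(l, j, i, m)`: families `E₃, E₂, E₆, E₁, E₅, E₄`
  have h := card_le_card_goods_above_threeCycleSource S hgmono E₃ E₂ E₆ E₁ E₅ E₄ hjl.symm hil.symm hlm hij.symm hjm him
    h3S (ga h3b) (gb h3S h3a) h2S (ga h2b) (gb h2S h2a) h6S (ga h6b) (gb h6S h6a) h1S (ga h1b) (gb h1S h1a)
    h5S (ga h5b) (gb h5S h5a) h4S (ga h4b) (gb h4S h4a)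
  have hset : {U ∈ S.powerset | g U = top ∧ g (S \ U) = bot ∧ ∃ X ∈ E₃ ∪ E₂ ∪ E₆ ∪ E₁ ∪ E₅ ∪ E₄, X ⊆ U} =
      {U ∈ S.powerset | f U = top ∧ f (S \ U) = bot ∧ ∃ X ∈ E₁ ∪ E₂ ∪ E₃ ∪ E₄ ∪ E₅ ∪ E₆, X ⊆ U} := by
    ext U
    simp only [mem_filter, mem_powerset, hg, d_top, d_bot]
    constructor
    · rintro ⟨hUS, h1, h2, X, hX, hXU⟩
      rw [Finset.sdiff_sdiff_eq_self hUS] at h2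
      refine ⟨hUS, h2, h1, X, ?_, hXU⟩
      simp only [mem_union] at hX ⊢; tauto
    · rintro ⟨hUS, h1, h2, X, hX, hXU⟩
      refine ⟨hUS, h2, ?_, X, ?_, hXU⟩
      · rw [Finset.sdiff_sdiff_eq_self hUS]; exact h1
      · simp only [mem_union] at hX ⊢; tauto
  rw [hset] at h
  omega

/-- **Theorem O for the 3-cycle with a sink on four petals** (Hall form): the bads admit DISTINCT good representatives above them
(domain grouped as in the dual certificate). -/
theorem exists_injective_good_above_threeCycleSink (S : Finset α) {f : Finset α → Lab k}
    (hf : ∀ ⦃X Y : Finset α⦄, X ⊆ Y → f X ≤ f Y) (E₁ E₂ E₃ E₄ E₅ E₆ : Finset (Finset α)) {i j l m : Fin k}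
    (hij : i ≠ j) (hil : i ≠ l) (him : i ≠ m) (hjl : j ≠ l) (hjm : j ≠ m) (hlm : l ≠ m)
    (h1S : ∀ X ∈ E₁, X ⊆ S) (h1a : ∀ X ∈ E₁, f X = petal i) (h1b : ∀ X ∈ E₁, f (S \ X) = petal j)
    (h2S : ∀ X ∈ E₂, X ⊆ S) (h2a : ∀ X ∈ E₂, f X = petal i) (h2b : ∀ X ∈ E₂, f (S \ X) = petal l)
    (h3S : ∀ X ∈ E₃, X ⊆ S) (h3a : ∀ X ∈ E₃, f X = petal j) (h3b : ∀ X ∈ E₃, f (S \ X) = petal l)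
    (h4S : ∀ X ∈ E₄, X ⊆ S) (h4a : ∀ X ∈ E₄, f X = petal j) (h4b : ∀ X ∈ E₄, f (S \ X) = petal m)
    (h5S : ∀ X ∈ E₅, X ⊆ S) (h5a : ∀ X ∈ E₅, f X = petal m) (h5b : ∀ X ∈ E₅, f (S \ X) = petal i)
    (h6S : ∀ X ∈ E₆, X ⊆ S) (h6a : ∀ X ∈ E₆, f X = petal m) (h6b : ∀ X ∈ E₆, f (S \ X) = petal l)
    : ∃ φ : ↥((E₆ ∪ E₅) ∪ (E₂ ∪ E₁) ∪ (E₃ ∪ E₄)) → Finset α, Function.Injective φ ∧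
        ∀ X : ↥((E₆ ∪ E₅) ∪ (E₂ ∪ E₁) ∪ (E₃ ∪ E₄)), (X : Finset α) ⊆ φ X ∧ φ X ⊆ S ∧ f (φ X) = top ∧ f (S \ φ X) = bot := by
  -- the dual label `d` (swap `B` and `A`, fix the petals) and the dual labeling `g U = d (f (S \ U))`
  set d : Lab k → Lab k := fun c => if c = bot then top else if c = top then bot else c with hd
  have d_anti : ∀ {x y : Lab k}, x ≤ y → d y ≤ d x := by
    intro x y h
    rw [le_def] at h ⊢
    rcases h with h | h | h <;> subst h
    · cases y <;> simp [hd]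
    · cases x <;> simp [hd]
    · exact Or.inr (Or.inr rfl)
  have d_top : ∀ {c : Lab k}, d c = top ↔ c = bot := fun {c} => by cases c <;> simp [hd]
  have d_bot : ∀ {c : Lab k}, d c = bot ↔ c = top := fun {c} => by cases c <;> simp [hd]
  have d_petal : ∀ q : Fin k, d (petal q) = petal q := fun q => by simp [hd]
  set g : Finset α → Lab k := fun U => d (f (S \ U)) with hg
  have hgmono : ∀ ⦃X Y : Finset α⦄, X ⊆ Y → g X ≤ g Y := fun X Y hXY => d_anti (hf (sdiff_subset_sdiff le_rfl hXY))
  have ga : ∀ {E : Finset (Finset α)} {q : Fin k}, (∀ X ∈ E, f (S \ X) = petal q) → ∀ X ∈ E, g X = petal q := by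
    intro E q h X hX; simp only [hg, h X hX, d_petal]
  have gb : ∀ {E : Finset (Finset α)} {p : Fin k}, (∀ X ∈ E, X ⊆ S) → (∀ X ∈ E, f X = petal p) →
      ∀ X ∈ E, g (S \ X) = petal p := by
    intro E p hS h X hX; simp only [hg, Finset.sdiff_sdiff_eq_self (hS X hX), h X hX, d_petal]
  obtain ⟨φ, hφinj, hφ⟩ := exists_injective_good_above_threeCycleSource S hgmono E₃ E₂ E₆ E₁ E₅ E₄ hjl.symm hil.symm hlm
    hij.symm hjm him
    h3S (ga h3b) (gb h3S h3a) h2S (ga h2b) (gb h2S h2a) h6S (ga h6b) (gb h6S h6a) h1S (ga h1b) (gb h1S h1a)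
    h5S (ga h5b) (gb h5S h5a) h4S (ga h4b) (gb h4S h4a)
  refine ⟨φ, hφinj, fun X => ?_⟩
  obtain ⟨hXφ, hφS, htop, hbot⟩ := hφ X
  simp only [hg, d_top, d_bot, Finset.sdiff_sdiff_eq_self hφS] at htop hbot
  exact ⟨hXφ, hφS, hbot, htop⟩

end OrientedAntipodalHall

end Summit.CriticalPhenomena.PercolationContinuityZ3.Theorems
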